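import Mathlib.RepresentationTheory.Irreducible
import Mathlib.Analysis.Complex.Basic
import Literature.NumberTheory.Automorphic.SmoothRepresentation
import HarnessLib

/-!
# Liu 2021, Appendix D §D.1 — the local oscillator representation `ω(μ, ε, χ)` of a
# non-archimedean unitary group is irreducible and admissible

Source (held arXiv text, corpus key `paper:arxiv-2102.11518`, chunk p0056; the appendix is §10
of the extraction's numbering = Appendix D of the compiled arXiv version — author's TeX `FJcycle.tex`:
`\appendix` l. 4010, appendices A (Li–Zhu), B (poles of Eisenstein series), C (Shimura varieties),
D (cohomology of unitary Shimura curves) at ll. 4015/4218/4544/5201, this lemma = `le:weil_nonarch`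
l. 5226 = Lemma D.1; the Cambridge J. Math. lettering is unconfirmed.  ERRATUM 2026-08-20: earlier
revisions of this record wrote "Appendix B §B.1 / Lemma B.1" throughout; the arXiv pin "Lemma 10.1,
p. 56" was always correct; the siblings `LocalOscillatorDatumOfCentralChar.lean` and
`../CentralCharacterQuotient.lean` still carry the old letter in prose only):
Yifeng Liu, *Fourier–Jacobi cycles and arithmetic relative trace formula* (with an appendix by
Chao Li and Yihang Zhu), Camb. J. Math. **9** (2021), no. 1 = arXiv:2102.11518.  Bib key `Liu2021`.

## 1. Verbatim quotations (arXiv:2102.11518, §10.1 = App. D §D.1, chunk p0056; `$…$` = the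
## held text's TeX, in which a few macro symbols are dropped by the extraction — restored in
## brackets `[…]` from the surrounding prose, never from memory of the statement)

* Standing hypotheses (p0056 L8): "Let $F$ be a local field whose characteristic is not $2$. Let
  $E$ be an étale $F$-algebra of rank $2$. Denote by [c] the unique nontrivial involution on $E$
  that fixes $F$, and put $E^- [=] \{x\in E [:] x+x^[c] =0\}$ and $E^1 [=] \{x\in E [:] xx^[c]
  =1\}$. Let [V],(\;,\;)_[V]$ be a (non-degenerate) hermitian space over $E$ (with respect to
  [c]) of rank $n\geq 2$."
* (p0056 L10): "We recall the construction of oscillator representations of $[U]([V])$ in three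
  steps."
* Step 1 (p0056 L12): "Choose an element $\varepsilon\in E^-\times/[N]_{E/F}E^\times$. Let
  $[V]_\varepsilon$ be the underlying $F$-vector space of $[V]$ equipped with the form
  $[Tr]_{E/F}\varepsilon(\;,\;)_[V]$, which becomes a symplectic space. More precisely, we have to
  choose an element in $E^-\times$ in the coset $\varepsilon$; and it is known that the
  resulting oscillator representation depends only on $\varepsilon$. Let $[Mp]([V]_\varepsilon)$
  be the metaplectic group of $[V]_\varepsilon$ with center $[ℂ]^1$. Then we have the oscillator
  representation $\omega(\varepsilon)$ of $[Mp]([V]_\varepsilon)$ using the standard additive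
  character $\psi_F$."
* Step 2 (p0056 L14): "Choose a character $\mu [:] E^\times\to [ℂ]^1$ such that
  $\mu [|_{F^\times}]$ is the unique character whose kernel is exactly $[N]_{E/F}E^\times$. Then
  we have the induced homomorphism $[ι]_\mu [:] [U]([V])\to [Mp]([V]_\varepsilon)$ (see, for
  example, [HKS]*Section 1). Put $\omega(\mu,\varepsilon) [:=] \omega(\varepsilon)\circ
  [ι]_\mu$."
* Step 3 (p0056 L16): "Choose a character $[χ] [:] E^1\to [ℂ]^1$. Let
  $\omega(\mu,\varepsilon,[χ])$ be the maximal quotient of the representation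
  $\omega(\varepsilon,\mu)$ of $[U]([V])$ with central character $[χ]$."
* (p0056 L18): "For $[χ]$ in Step 3, we define a character $[χ̌]$ of $E^\times$ via the formula
  $[χ̌](x)=[χ](x/x^[c])$."
* **Lemma 10.1** (= App. D, §D.1, first Lemma = Lemma D.1; p0056 L20–L23): "Suppose that $F$ is
  nonarchimedean. Then $\omega(\mu,\varepsilon,[χ])$ is irreducible and admissible. Moreover,
  - $\omega(\mu,\varepsilon,[χ])$ is zero if and only if $E$ is a field, $[V]$ is anisotropic
    (in particular $n=2$), and $[χ̌]=\mu^2$."  (the dropped symbol before `=\mu^2` is the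
    character `χ̌` of `E^×` of L18 — the author's TeX l. 5224/5229 has `\check\chi` — both sides being
    characters of `E^×`)
  (the further bullets — contragredient, and the isomorphism criteria for `n ≥ 3` / `n = 2` —
  are NOT transcribed into the record).
* From the proof (p0056 L38–L40), used only for the object match (d) below: "Note that, since
  $E^1$ is compact, we have a canonical isomorphism of representations of $[U]([V])$
  \[ \omega(\mu,\varepsilon) [≅ ⊕]_{[χ]} \omega(\mu,\varepsilon,[χ]). \]"

## 2. What the record says, and what it does not

`LocalOscillatorDatum.IrreducibleAdmissible D` transcribes the first sentence of Lemma 10.1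
together with its bullet (1) in the direction the consumers use, clause by clause: the maximal
`χ`-quotient `ω(μ, ε, χ)` (field `D.quot`) is ADMISSIBLE; it is IRREDUCIBLE whenever it is
non-zero; and it is NON-ZERO unless `n = 2` (print's exceptional case "E is a field, V is
anisotropic (in particular n = 2), and χ̌ = μ²" entails `n = 2`; only this printed consequence is
retained, over the numeric field `D.rank` = `n`).  Mathlib's
`Representation.IsIrreducible` entails that the space is non-trivial, whereas print's
"irreducible … Moreover, ω(μ,ε,χ) is zero if and only if …" allows the zero representation in
the exceptional case; the clause `Nontrivial W → IsIrreducible` is therefore implied by the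
printed lemma under either reading of "irreducible", and `rank ≠ 2 → Nontrivial W` is the
contrapositive of bullet (1)'s "zero ⇒ … (in particular n = 2)".  "Admissible" is the tree's
`Representation.IsAdmissible`
(`Literature/NumberTheory/Automorphic/SmoothRepresentation.lean`: smooth, and `V^K` finitely
generated for every compact open `K`) — print's notion for smooth representations of the
totally disconnected group `U(V)(F)`.

The record is a `def … : Prop` over an abstract datum and ASSERTS NOTHING by itself: it is a
hypothesis `(h : D.IrreducibleAdmissible)` of its consumers, to be cited (one MODEL-N row, id
N-f1 of the pub-hodgecm registry) only at an instance `D` whose fields ARE print's objects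
(§3).  Over an arbitrary datum the proposition is in general false (take `omega` trivial on a
large space), exactly as for every datum-style record of this directory.

## 3. Object match — obligations of the citing instance (READ from §1, not quoted)

(a) `G` = `U(V)(F)` with its locally profinite topology, for `F` a NON-ARCHIMEDEAN local field of
    characteristic `≠ 2`, `E/F` étale of rank 2, `V` a non-degenerate hermitian `E`-space of
    rank `n ≥ 2` (standing hypotheses, p0056 L8).
(b) `D.omega` = `ω(μ, ε) = ω(ε) ∘ ι_μ`: the oscillator (Weil) representation of `Mp(V_ε)` for
    the standard additive character `ψ_F` on its smooth model (Step 1), pulled back along the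
    splitting `ι_μ : U(V) → Mp(V_ε)` of [HKS, §1] determined by `μ` with
    `μ|_{F^×} = ` the quadratic character of kernel `N_{E/F}E^×` (Step 2).
(c) `D.zeta` = the inclusion of the centre `E¹ ↪ U(V)` (scalars), `D.chi` = `χ : E¹ → ℂ¹`
    (Step 3), a character in print's sense: CONTINUOUS with values of norm one (for a
    discontinuous `χ` of the compact group `E¹` the `χ`-quotient of a smooth representation is
    zero, and the record is then not print's statement — the datum carries no topology on `Z`, so
    this is an object-match duty).
(d) `D.quot`, `D.proj` = the MAXIMAL quotient of `ω(ε, μ)|_{U(V)}` with central character `χ`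
    (Step 3): `proj` is a `U(V)`-equivariant surjection on which `E¹` acts through `χ`, and its
    kernel is exactly the span of the vectors `ω(z)v − χ(z)v` (`z ∈ E¹`) — field `ker_proj` —
    so that `D.quot` is the largest such quotient (equivalently, by compactness of `E¹`, the
    `χ`-isotypic summand, p0056 L38–L40).
(e) `D.rank` = `n = rank_E V` (`D.two_le_rank` = the standing "rank n ≥ 2"); for the
    pub-hodgecm cell `n = 3`, so the non-vanishing clause applies (`3 ≠ 2`).
(om1) SPLIT-CONSISTENCY (carver hazard): the splitting `ι_μ` inside `D.omega` must be THE SAME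
    local splitting that the cell's global compatible splitting (record
    `Literature.NumberTheory.GelbartRogawski1991.SplittingDatum.CompatibleSplitting`, row N-d2)
    induces at this place; two splittings differ by a character of `U(V)(F)` (a central twist,
    cf. `SplittingDatum.IsCompatible.exists_central_twist`), and such a twist CHANGES which
    `χ`-quotient is "`ω(μ, ε, χ)`" — an instance built on a renormalised splitting must thread the
    twist through `D.chi` explicitly.
(om2) SMOOTHNESS: Liu's `ω`'s are smooth representations of the totally disconnected group
    `U(V)(F)`; the tree's `Representation.IsAdmissible` is BY DEFINITION `IsSmooth ∧ (finite
    `K`-invariants for compact open `K`)`, so the record's admissibility clause contains the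
    smoothness of `D.quot` (corollary `IrreducibleAdmissible.isSmooth`); nothing further is added
    to the datum.
Liu's proof cites Howe duality ([GT16] Thm 1.1 (1)) and, at split places, unitary parabolic
induction ([GR90] 2.6); these are inside the published lemma and are not hypotheses of ours.
-/

namespace Literature.RepresentationTheory.Liu2021

universe uG uZ uV uW

/-- The data of [Liu2021, App. D §D.1, Steps 1–3] at ONE non-archimedean place, recorded
abstractly (nothing asserted): a representation `omega` (print: `ω(μ, ε) = ω(ε) ∘ ι_μ` of
`U(V)(F)`), a central subgroup `zeta : Z →* G` (print: `E¹ ↪ U(V)`), a character `chi` of it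
(print: `χ`), and the maximal quotient `quot`/`proj` of `omega` on which `Z` acts through `chi`
(print: `ω(μ, ε, χ)`), with `ker_proj` pinning the quotient as the MAXIMAL one; `rank` is print's
`n` (with `2 ≤ n`).  See the module docstring §3 for the object match the
citing instance must satisfy. [cite: Liu2021, App. D §D.1 Steps 1–3, arXiv p. 56] -/
structure LocalOscillatorDatum (G : Type uG) (Z : Type uZ) [Group G] [TopologicalSpace G]
    [CommGroup Z] (V : Type uV) (W : Type uW) [AddCommGroup V] [Module ℂ V] [AddCommGroup W]
    [Module ℂ W] where
  /-- print: `ω(μ, ε) := ω(ε) ∘ ι_μ`, a representation of `U(V)(F)` (Step 2). -/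
  omega : Representation ℂ G V
  /-- print: the centre `E¹` of `U(V)` (Step 3 "central character"). -/
  zeta : Z →* G
  /-- `zeta` lands in the centre of `G`. -/
  zeta_mem_center : ∀ z, zeta z ∈ Subgroup.center G
  /-- print: `χ : E¹ → ℂ¹` (Step 3). -/
  chi : Z →* ℂˣ
  /-- print: `ω(μ, ε, χ)`, "the maximal quotient of the representation `ω(ε, μ)` of `U(V)` with
  central character `χ`" (Step 3) — its `U(V)`-action. -/
  quot : Representation ℂ G W
  /-- the quotient map `ω(μ, ε) → ω(μ, ε, χ)`. -/
  proj : V →ₗ[ℂ] W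
  /-- the quotient map is onto. -/
  proj_surjective : Function.Surjective proj
  /-- the quotient map is `U(V)`-equivariant. -/
  proj_comm : ∀ g v, proj (omega g v) = quot g (proj v)
  /-- MAXIMALITY: the kernel of the quotient map is exactly the span of the vectors
  `ω(z)v − χ(z)v`, `z ∈ E¹`, so `quot` is the largest quotient with central character `χ` (that the
  centre acts on `quot` through `χ` FOLLOWS: lemma `quot_zeta`). -/
  ker_proj : LinearMap.ker proj =
    ⨆ z : Z, LinearMap.range (omega (zeta z) - (chi z : ℂ) • LinearMap.id)
  /-- print's `n` = the `E`-rank of the hermitian space `V` (standing hypotheses, p0056 L8). -/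
  rank : ℕ
  /-- print's standing hypothesis, verbatim (p0056 L8): "a (non-degenerate) hermitian space over
  `E` … of rank `n ≥ 2`". -/
  two_le_rank : 2 ≤ rank

namespace LocalOscillatorDatum

variable {G : Type uG} {Z : Type uZ} [Group G] [TopologicalSpace G] [CommGroup Z]
  {V : Type uV} {W : Type uW} [AddCommGroup V] [Module ℂ V] [AddCommGroup W] [Module ℂ W]

/-- **[Liu2021, App. D §D.1, Lemma D.1 = arXiv Lemma 10.1, first sentence + (1)]** as a named
published fact about the datum `D` (one cited hypothesis; registry row N-f1):
"Suppose that `F` is nonarchimedean. Then `ω(μ, ε, χ)` is irreducible and admissible. Moreover,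
`ω(μ, ε, χ)` is zero if and only if `E` is a field, `V` is anisotropic (in particular `n = 2`),
and `χ̌ = μ²`."  Typed clause by clause: the maximal `χ`-quotient `D.quot` is ADMISSIBLE; it is
IRREDUCIBLE in Mathlib's sense (which includes non-triviality) whenever it is non-zero (first
sentence, under either reading of print's "irreducible"); and it is NON-ZERO outside print's
exceptional case, of which only the printed consequence "`n = 2`" is retained: `D.rank ≠ 2 →
Nontrivial W` (bullet (1), direction "zero ⇒ … in particular `n = 2`").  A `Prop`-valued
definition,
asserted nowhere in this file; see the module docstring §2–§3.
[cite: Liu2021, App. D Lemma D.1 (arXiv:2102.11518 Lemma 10.1), arXiv p. 56] -/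
def IrreducibleAdmissible (D : LocalOscillatorDatum G Z V W) : Prop :=
  D.quot.IsAdmissible ∧ (Nontrivial W → D.quot.IsIrreducible) ∧ (D.rank ≠ 2 → Nontrivial W)

/-- Admissibility clause of the record. [cite: Liu2021, App. D Lemma D.1, arXiv p. 56] -/
theorem IrreducibleAdmissible.isAdmissible {D : LocalOscillatorDatum G Z V W}
    (h : D.IrreducibleAdmissible) : D.quot.IsAdmissible :=
  h.1

/-- Irreducibility clause of the record, outside print's exceptional case.
[cite: Liu2021, App. D Lemma D.1, arXiv p. 56] -/
theorem IrreducibleAdmissible.isIrreducible {D : LocalOscillatorDatum G Z V W}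
    (h : D.IrreducibleAdmissible) (hn : D.rank ≠ 2) : D.quot.IsIrreducible :=
  h.2.1 (h.2.2 hn)

/-- Irreducibility clause of the record for a quotient known to be non-zero.
[cite: Liu2021, App. D Lemma D.1, arXiv p. 56] -/
theorem IrreducibleAdmissible.isIrreducible_of_nontrivial {D : LocalOscillatorDatum G Z V W}
    (h : D.IrreducibleAdmissible) [Nontrivial W] : D.quot.IsIrreducible :=
  h.2.1 ‹_›

/-- Non-vanishing clause of the record (bullet (1), contrapositive of "zero ⇒ … `n = 2`").
[cite: Liu2021, App. D Lemma D.1 (1), arXiv p. 56] -/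
theorem IrreducibleAdmissible.nontrivial {D : LocalOscillatorDatum G Z V W}
    (h : D.IrreducibleAdmissible) (hn : D.rank ≠ 2) : Nontrivial W :=
  h.2.2 hn

/-- The pub-hodgecm cell's case `n = 3`: the quotient is non-zero and irreducible.
[cite: Liu2021, App. D Lemma D.1, arXiv p. 56] -/
theorem IrreducibleAdmissible.isIrreducible_of_rank_eq_three {D : LocalOscillatorDatum G Z V W}
    (h : D.IrreducibleAdmissible) (h3 : D.rank = 3) : D.quot.IsIrreducible :=
  h.isIrreducible (by omega)

/-- Smoothness of `ω(μ, ε, χ)` (admissible ⇒ smooth, tree lemma `IsAdmissible.isSmooth`).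
[cite: Liu2021, App. D Lemma D.1, arXiv p. 56] -/
theorem IrreducibleAdmissible.isSmooth {D : LocalOscillatorDatum G Z V W}
    (h : D.IrreducibleAdmissible) : D.quot.IsSmooth :=
  h.1.isSmooth

/-! ### Kernel facts about the datum (no citation needed) -/

/-- The vectors `ω(z)v − χ(z)v` die in the quotient (they lie in `ker proj` by `ker_proj`).
[folklore] -/
theorem proj_omega_zeta_sub (D : LocalOscillatorDatum G Z V W) (z : Z) (v : V) :
    D.proj (D.omega (D.zeta z) v - (D.chi z : ℂ) • v) = 0 := by
  have hmem : D.omega (D.zeta z) v - (D.chi z : ℂ) • v ∈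
      ⨆ z : Z, LinearMap.range (D.omega (D.zeta z) - (D.chi z : ℂ) • LinearMap.id) :=
    Submodule.mem_iSup_of_mem z ⟨v, rfl⟩
  rw [← D.ker_proj] at hmem
  exact hmem

/-- The centre acts on the maximal quotient through `χ` (from `ker_proj`, equivariance and
surjectivity of `proj`). [folklore] -/
theorem quot_zeta (D : LocalOscillatorDatum G Z V W) (z : Z) (w : W) :
    D.quot (D.zeta z) w = (D.chi z : ℂ) • w := by
  obtain ⟨v, rfl⟩ := D.proj_surjective w
  have h := D.proj_omega_zeta_sub z v
  rw [map_sub, map_smul, D.proj_comm, sub_eq_zero] at h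
  exact h

/-- On the quotient the centre acts by the scalar `χ(z)`: `quot (zeta z) = χ(z) • id`.
[folklore] -/
theorem quot_zeta_eq (D : LocalOscillatorDatum G Z V W) (z : Z) :
    D.quot (D.zeta z) = (D.chi z : ℂ) • LinearMap.id := by
  ext w
  simp [D.quot_zeta]

/-- Equivariance of the quotient map, composition form. [folklore] -/
theorem proj_comp_omega (D : LocalOscillatorDatum G Z V W) (g : G) :
    D.proj ∘ₗ D.omega g = D.quot g ∘ₗ D.proj := by
  ext v
  simp [D.proj_comm]

/-- UNIVERSAL PROPERTY of the maximal quotient (from `ker_proj`): a linear map out of `ω(μ, ε)`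
that kills every `ω(z)v − χ(z)v` vanishes on `ker proj`, hence factors through `ω(μ, ε, χ)`.
[folklore] -/
theorem ker_proj_le_ker {U : Type*} [AddCommGroup U] [Module ℂ U]
    (D : LocalOscillatorDatum G Z V W) (f : V →ₗ[ℂ] U)
    (hf : ∀ z v, f (D.omega (D.zeta z) v) = (D.chi z : ℂ) • f v) :
    LinearMap.ker D.proj ≤ LinearMap.ker f := by
  rw [D.ker_proj]
  refine iSup_le fun z => ?_
  rintro _ ⟨v, rfl⟩
  simp [LinearMap.mem_ker, hf]

/-- The factorisation through the maximal quotient: for `f` as in `ker_proj_le_ker` there is a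
(unique) linear `f' : ω(μ, ε, χ) → U` with `f = f' ∘ proj`. [folklore] -/
theorem exists_factor {U : Type*} [AddCommGroup U] [Module ℂ U]
    (D : LocalOscillatorDatum G Z V W) (f : V →ₗ[ℂ] U)
    (hf : ∀ z v, f (D.omega (D.zeta z) v) = (D.chi z : ℂ) • f v) :
    ∃ f' : W →ₗ[ℂ] U, f = f' ∘ₗ D.proj := by
  classical
  have hle := D.ker_proj_le_ker f hf
  -- `proj` is surjective, so `W ≃ V ⧸ ker proj`; descend `f` to the quotient.
  let e : (V ⧸ LinearMap.ker D.proj) ≃ₗ[ℂ] W :=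
    D.proj.quotKerEquivOfSurjective D.proj_surjective
  refine ⟨(LinearMap.ker D.proj).liftQ f hle ∘ₗ e.symm.toLinearMap, ?_⟩
  ext v
  have : e.symm (D.proj v) = Submodule.Quotient.mk v := by
    rw [LinearEquiv.symm_apply_eq]
    rfl
  simp [this]

/-- Uniqueness in the universal property: two maps agreeing after `proj` are equal. [folklore] -/
theorem factor_unique {U : Type*} [AddCommGroup U] [Module ℂ U]
    (D : LocalOscillatorDatum G Z V W) {f₁ f₂ : W →ₗ[ℂ] U}
    (h : f₁ ∘ₗ D.proj = f₂ ∘ₗ D.proj) : f₁ = f₂ :=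
  LinearMap.cancel_right D.proj_surjective |>.mp h

end LocalOscillatorDatum

end Literature.RepresentationTheory.Liu2021
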